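import Mathlib
import HarnessLib
import Summits.HubbardSuperconductivity.HubbardSuperconductivity.Theorems.KLProgrammeKLRegimeTwoVolumeLipDiffSups
import Summits.HubbardSuperconductivity.HubbardSuperconductivity.Theorems.KLProgrammeKLRegimeTwoVolumeLipBaseOfGrid

/-!
# Route `KLProgramme` — crux K3 ENGINE (stmt-HubbardSuperconductivity-20437 `KLRegimeEngineV17F2`), stub (e) proof-input «(e)-D-ROWS», two-volume Lipschitz tower:
# THE CRUDE (ALL-PINS) CAPS of the difference sizes by ONE-VOLUME pinned sizes (seat hubbard-kl-k3c4-p1 g25, VL lane; `--supports` 20437; memo DROWS-SCOPE-g25.md §13.15)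

The row source hypothesis `hsμ` of the law of rows (`…TwoVolumeLipLawOfRowsBase1Boot`, p729019) contains the far-zone terms `gain × klLipBornDiffSup … d k′ (2m) 0` and
`gain × klLipInputDiffSup … d 1 (2m) 0` — difference sizes at depth `0` (ALL pins, no smallness), which only enter with the zone gain `1/(1 + Λ_T(r+1))`.  They are
capped by one-volume data: the difference is `W′ − klGlue W`, the glued element's pinned sum at a fine pin is the coarse element's at the residue pin
(`sum_pinned_norm_kernel_klGlue_eq`, triangle step `…TwoVolumeLipBaseOfGrid.sum_pinned_norm_kernel_sub_klGlue_le`), so every pinned sum of the difference is `≤ N′ + N` (fine + coarse one-volume pinned sizes), at any depth.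

* **`klLipBornDiffSup_le_crude`**, **`klLipInputDiffSup_le_crude`** — `≤ N′ + N` from the fine and coarse one-volume pinned sizes, every depth `R`.
Pure bookkeeping; nothing about the model is asserted; nothing asserts the (D) rows, (e), any stub, VL, K3 or superconductivity.
-/

noncomputable section

namespace Summit.HubbardSuperconductivity.HubbardSuperconductivity.Theorems.TwoVolumeLip

set_option linter.dupNamespace false -- summit = problem name (single-conjunct summit), D-0017

open Finset Literature.MathematicalPhysics.QuantumLattice GrassmannAlgebra Literature.Probability.LatticeModels
open Summit.HubbardSuperconductivity.HubbardSuperconductivity.Theorems.TwoVolumeSource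
open Summit.HubbardSuperconductivity.HubbardSuperconductivity.Theorems.TwoVolumeDefect

variable {L b M : ℕ} [NeZero L] [NeZero (b * L)]

/-- **Crude cap of the born difference size**: if the fine born object has pinned sizes `≤ N′` and the coarse one `≤ N` in degree `m`, then
`klLipBornDiffSup L b M β U μ K d k m R ≤ N′ + N` for every depth `R` (in particular `R = 0`). -/
theorem klLipBornDiffSup_le_crude (β U μ : ℝ) (K : TrigPolyC4v) (d k m R : ℕ) {N N' : ℝ} (hN0 : 0 ≤ N) (hN'0 : 0 ≤ N')
    (hN : ∀ (q : Fin m) (y : SpaceTimeIdx L M × SectorLeg (sectorCount (d * k))),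
      ∑ Y ∈ univ.filter (fun Y : Fin m → SpaceTimeIdx L M × SectorLeg (sectorCount (d * k)) => Y q = y), ‖kernel ℂ (klLipBorn L M β U μ K d k) m Y‖ ≤ N)
    (hN' : ∀ (q : Fin m) (y' : SpaceTimeIdx (b * L) M × SectorLeg (sectorCount (d * k))),
      ∑ Y' ∈ univ.filter (fun Y' : Fin m → SpaceTimeIdx (b * L) M × SectorLeg (sectorCount (d * k)) => Y' q = y'),
        ‖kernel ℂ (klLipBorn (b * L) M β U μ K d k) m Y'‖ ≤ N') :
    klLipBornDiffSup L b M β U μ K d k m R ≤ N' + N := by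
  refine klLipBornDiffSup_le_of_forall β U μ K d k m R (add_nonneg hN'0 hN0) fun q w _ => ?_
  rw [klLipBornDiff_def]
  exact (sum_pinned_norm_kernel_sub_klGlue_le _ _ q w).trans (add_le_add (hN' q w) (hN q _))

/-- **Crude cap of the measured (input) difference size**: if the fine input object has pinned sizes `≤ N′` and the coarse one `≤ N` in degree `m`, then
`klLipInputDiffSup L b M β U μ K d k m R ≤ N′ + N` for every depth `R`. -/
theorem klLipInputDiffSup_le_crude (β U μ : ℝ) (K : TrigPolyC4v) (d k m R : ℕ) {N N' : ℝ} (hN0 : 0 ≤ N) (hN'0 : 0 ≤ N')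
    (hN : ∀ (q : Fin m) (y : SpaceTimeIdx L M × SectorLeg (sectorCount (d * k - 1))),
      ∑ Y ∈ univ.filter (fun Y : Fin m → SpaceTimeIdx L M × SectorLeg (sectorCount (d * k - 1)) => Y q = y), ‖kernel ℂ (klLipInput L M β U μ K d k) m Y‖ ≤ N)
    (hN' : ∀ (q : Fin m) (y' : SpaceTimeIdx (b * L) M × SectorLeg (sectorCount (d * k - 1))),
      ∑ Y' ∈ univ.filter (fun Y' : Fin m → SpaceTimeIdx (b * L) M × SectorLeg (sectorCount (d * k - 1)) => Y' q = y'),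
        ‖kernel ℂ (klLipInput (b * L) M β U μ K d k) m Y'‖ ≤ N') :
    klLipInputDiffSup L b M β U μ K d k m R ≤ N' + N := by
  refine klLipInputDiffSup_le_of_forall β U μ K d k m R (add_nonneg hN'0 hN0) fun q w _ => ?_
  rw [klLipInputDiff_def]
  exact (sum_pinned_norm_kernel_sub_klGlue_le _ _ q w).trans (add_le_add (hN' q w) (hN q _))

end Summit.HubbardSuperconductivity.HubbardSuperconductivity.Theorems.TwoVolumeLip

end
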